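/-
Copyright (c) 2026 the pub-hodgecm-mathlib formalisation cell (harness21).  Prover seat hodgecm-mathlib-LH4-p09 (g8), req620 Track A «(D-RAM) FOUR-FRAME» squad
(heir dealer LH4-plan (g13) WORD #66 (2): (T-2tok) «the even-d two-token glued ∕ core-hanging cells» for F0P3a-p01 (g36)'s level trunks).  2026-09-04.
-/
import Summits.HodgeConjecture.HodgeConjecture.Theorems.F0P3cDyRamLabelledKappaGluedLocus              -- ★ p859791 (this seat) K4: G1 vacuity; brings ★ p859544 reads, ★ p859257 off-locus read, ★ (iv-a)
import Summits.HodgeConjecture.HodgeConjecture.Theorems.F0P3cDyRamLabelledKappaCoreHangingLocus        -- ★ p859740 (this seat) K2: H vacuity; brings ★ p859628 reads, ★ p859313 off-locus read, ★ B7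
import HarnessLib

/-!
# (D-RAM) four-frame, STAGE 1b — (T-2tok) REDUCTIONS: a two-token labelled cell `Σᶠ_{M ∈ stratum, L₁ M ∧ L₂ M} w(M)` on a glued ∕ core-hanging stratum
# IS a one-token cell (times a read) whenever one token is CONSTANT there, and is EMPTY when both tokens cut genuinely without a common fixed witness

Helper brick for dealer LH4-plan (g13) WORD #66 (2) and F0P3a-p01 (g36)'s 11:43Z request (T-2tok): `Theorems/` only, statement-first, ★-only imports, lane
`--supports stmt-HodgeConjecture-24833 --as helper`; it PAYS NO tier-0 row (count-neutral).  The weight `w` is ARBITRARY (`stabiliserWeight`, `κᵢ·stabiliserWeight`,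
`n₀·stabiliserWeight`, …), so every one-token ★ cell (this seat's K2–K6 ∕ p859544–p859628, LH4-p12 (g7)'s ★ p859714 ∕ p859817) lifts to the two-token label
`LatticeInLevel ϖ ℓ₁ (diag e₁) ∧ LatticeInLevel ϖ ℓ₂ (diag e₂)` BY NAME.

WHEN IS A TOKEN CONSTANT ON A STRATUM?  (a) OFF its locus (`|e₂−e₁| ≠ |e₂−e₀|·|ϖ|^s`): ★ p859257 ∕ ★ p859313 — the token is `[reads]` on the whole stratum;
(b) ON its locus in the VACUOUS regime `ℓ + 2ρ ≤ k`: §2∕§3 — the token is `[outer reads]` on the whole stratum (the ball on `κ` is all of it).  At the letters of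
record on `G1(ρ, 2t′)` the two loci `n₁ = n₂ + 2t′` (D₁) and `n₁ = n₂ + t′` (D₂) never meet, so one token is ALWAYS off its locus ⇒ §3 reduces every two-token
G1 cell to a one-token cell; on an equal-depth H datum both tokens are on the locus ⇒ §2 (vacuity) or §4 (both genuine: EMPTY unless a common fixed witness —
and for `(D₁, D₂)` on an equilateral datum there is none, ★ `not_exists_common_witness_sq`).

* §1 `finsum_sep_and_eq_ite_of_forall_iff_right ∕ _left` — generic: a conjunct constant on `S` factors out as an indicator.
* §2 H: `latticeInLevel_iff_outer_of_mem_stratum_H_of_vacuous`; HEADS `finsum_stratum_H_sep_and_eq_of_vacuous_right ∕ _left`, `…_of_ne_right ∕ _left`.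
* §3 G1: `latticeInLevel_iff_outer_of_mem_stratum_G1_of_vacuous`; HEADS `finsum_stratum_G1_sep_and_eq_of_vacuous_right ∕ _left`, `…_of_ne_right ∕ _left`.
* §4 BOTH GENUINE, NO COMMON FIXED WITNESS ⇒ EMPTY: `stratum_H_sep_and_eq_empty_of_no_common_witness`, `stratum_G1_sep_and_eq_empty_of_no_common_witness` (+ `Σ = 0`
  corollaries) — dualisability puts a fixed element within the class of `κ` (★ (iv-a) ∕ ★ B7 (iv) criteria), and both token balls are class conditions.

HONEST LABEL: helper organs for HYPOTHESES (the two-token labelled trunks ★ p859769 ∕ p859848 binders); STAGE-1b tier-0 rows T₊∕T₋∕regular and the ED. 5∕6 law stubs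
stay OPEN; HC_CM is proved only modulo the 7 printed citations (2 remaining named inputs: hLiu418 = `stmt-HodgeConjecture-24832`, h413 = `stmt-HodgeConjecture-24833`)
until rung 0 closes.

## References
* [Kottwitz1986BaseChangeUnits] R. E. Kottwitz, *Base change for unit elements of Hecke algebras*, Compositio Math. 60 (1986), §1 pp. 240–241 (lattice counts modulo the torus).
* [Rogawski1990] J. D. Rogawski, *Automorphic Representations of Unitary Groups in Three Variables*, Ann. of Math. Stud. 123 (1990), §4.9 Prop. 4.9.1 (a) p. 55.
* [Serre1980Trees] J.-P. Serre, *Trees*, Springer (1980), Ch. II §1.1 (the ultrametric inequality: balls are nested or disjoint).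
-/

set_option autoImplicit false

noncomputable section

namespace Summit.HodgeConjecture.HodgeConjecture.Cruxes.H413.F0P3cDyRamLabelledTwoTokenReductions

open Matrix WithZero
open Literature.NumberTheory.Automorphic Literature.NumberTheory.Automorphic.HermitianLattice
open Literature.NumberTheory.Automorphic.UnitaryLatticeTree Literature.NumberTheory.Automorphic.UnitaryThreeFourFrame
open Literature.NumberTheory.LocalFields.WildQuadraticDatum
open Summit.HodgeConjecture.HodgeConjecture.Cruxes.H413.F0P3cDyRamDiagonalTorusDefs
open Summit.HodgeConjecture.HodgeConjecture.Cruxes.H413.F0P3cDyRamDiagonalStrataDefs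
open Summit.HodgeConjecture.HodgeConjecture.Cruxes.H413.F0P3cDyRamDiagonalGluedStabiliserIndex (ne_zero_and_v_lt_one_of_v_eq_exp)
open Summit.HodgeConjecture.HodgeConjecture.Cruxes.H413.F0P3cDyRamDiagonalGluedStabiliserMembership (pow_mul_le_pow_add_iff)
open Summit.HodgeConjecture.HodgeConjecture.Cruxes.H413.F0P3cDyRamDiagonalGluedStratum (stratum_G1_eq)
open Summit.HodgeConjecture.HodgeConjecture.Cruxes.H413.F0P3cDyRamDiagonalGluedTorusOrbits (exists_gl_coe_eq_glued isDualisableLattice_latt_glued_iff_exists_fixed_kappa)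
open Summit.HodgeConjecture.HodgeConjecture.Cruxes.H413.F0P3cDyRamDiagonalCoreHangingOrbits (isDualisableLattice_latt_coreHanging_iff_exists_fixed_kappa)
open Summit.HodgeConjecture.HodgeConjecture.Cruxes.H413.F0P3cDyRamDiagonalCoreHangingSocket (stratum_H_eq)
open Summit.HodgeConjecture.HodgeConjecture.Cruxes.H413.F0P3cDyRamFourFrameCensusDefs
open Summit.HodgeConjecture.HodgeConjecture.Cruxes.H413.F0P3cDyRamLabelledSplitStrata (finsum_mem_sep_eq_ite_of_forall_iff)
open Summit.HodgeConjecture.HodgeConjecture.Cruxes.H413.F0P3cDyRamLabelledGluedStratumRead (latticeInLevel_diagonal_latt_G1_iff_of_ne)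
open Summit.HodgeConjecture.HodgeConjecture.Cruxes.H413.F0P3cDyRamLabelledCoreHangingStratumRead (latticeInLevel_diagonal_latt_H_iff_of_ne)
open Summit.HodgeConjecture.HodgeConjecture.Cruxes.H413.F0P3cDyRamLabelledGluedLocusCensus (latticeInLevel_diagonal_latt_glued_iff_onLocus v_glueRatio_eq tokenBall_of_le)
open Summit.HodgeConjecture.HodgeConjecture.Cruxes.H413.F0P3cDyRamLabelledCoreHangingLocusCensus (latticeInLevel_diagonal_latt_coreHanging_iff_onLocus tokenBall_unit_of_le)
open scoped Valued WithZero Matrix MatrixGroups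

/-! ## §1  A conjunct constant on the set factors out -/

section Sep

variable {γ : Type*}

/-- If `Q₂ ↔ P₂` on all of `S`: `Σᶠ_{a ∈ S, Q₁ a ∧ Q₂ a} w = [P₂] · Σᶠ_{a ∈ S, Q₁ a} w`. [cite: Kottwitz1986BaseChangeUnits, §1 pp. 240–241] -/
theorem finsum_sep_and_eq_ite_of_forall_iff_right (S : Set γ) (Q₁ Q₂ : γ → Prop) (P₂ : Prop) [Decidable P₂] (h : ∀ a ∈ S, Q₂ a ↔ P₂) (w : γ → ℚ) :
    ∑ᶠ a ∈ {a | a ∈ S ∧ (Q₁ a ∧ Q₂ a)}, w a = if P₂ then ∑ᶠ a ∈ {a | a ∈ S ∧ Q₁ a}, w a else 0 := by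
  by_cases hP : P₂
  · rw [if_pos hP]
    exact finsum_mem_congr (Set.ext fun a => ⟨fun ha => ⟨ha.1, ha.2.1⟩, fun ha => ⟨ha.1, ha.2, (h a ha.1).2 hP⟩⟩) fun _ _ => rfl
  · rw [if_neg hP]
    have hemp : {a | a ∈ S ∧ (Q₁ a ∧ Q₂ a)} = ∅ := Set.eq_empty_of_forall_notMem fun a ha => hP ((h a ha.1).1 ha.2.2)
    rw [hemp, finsum_mem_empty]

/-- If `Q₁ ↔ P₁` on all of `S`: `Σᶠ_{a ∈ S, Q₁ a ∧ Q₂ a} w = [P₁] · Σᶠ_{a ∈ S, Q₂ a} w`. [cite: Kottwitz1986BaseChangeUnits, §1 pp. 240–241] -/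
theorem finsum_sep_and_eq_ite_of_forall_iff_left (S : Set γ) (Q₁ Q₂ : γ → Prop) (P₁ : Prop) [Decidable P₁] (h : ∀ a ∈ S, Q₁ a ↔ P₁) (w : γ → ℚ) :
    ∑ᶠ a ∈ {a | a ∈ S ∧ (Q₁ a ∧ Q₂ a)}, w a = if P₁ then ∑ᶠ a ∈ {a | a ∈ S ∧ Q₂ a}, w a else 0 := by
  rw [← finsum_sep_and_eq_ite_of_forall_iff_right S Q₂ Q₁ P₁ h w]
  exact finsum_mem_congr (Set.ext fun a => ⟨fun ha => ⟨ha.1, ha.2.2, ha.2.1⟩, fun ha => ⟨ha.1, ha.2.2, ha.2.1⟩⟩) fun _ _ => rfl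

end Sep

/-! ## §2  The core-hanging stratum `H (2ρ, 2ρ, 2ρ)` -/

section CoreHanging

variable {K : Type} [Field K] [Valued K ℤᵐ⁰] {σ : K →+* K} {ϖ : K} {d t : ℕ} {T : GL (Fin 3) K}

/-- **ON THE LOCUS, IN THE VACUOUS REGIME, THE TOKEN IS ITS OUTER READ** on `H (2ρ, 2ρ, 2ρ)`: with `v(e₂−e₀) = v(e₂−e₁) = k` and `ℓ + 2ρ ≤ k`, for every member
`M` of the stratum `diag(e)M ⊆ ϖ^ℓM ⟺ (([|eᵢ| ≤ |ϖ|^ℓ] ∧ |e₁−e₀| ≤ |ϖ|^{ℓ+ρ}) ∧ ℓ + ρ ≤ k)` (★ p859628 read; the ball on the unit `κ` is everything).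
[cite: Kottwitz1986BaseChangeUnits, §1 pp. 240–241] -/
theorem latticeInLevel_iff_outer_of_mem_stratum_H_of_vacuous (hD : IsRamifiedQuadraticDatum σ ϖ d t) (T : GL (Fin 3) K) (ρ : ℕ) (hρ : 1 ≤ ρ) (ℓ k : ℕ)
    (e : Fin 3 → K) (hk : Valued.v (e 2 - e 0) = Valued.v ϖ ^ k) (hloc : Valued.v (e 2 - e 1) = Valued.v ϖ ^ k) (hvac : ℓ + 2 * ρ ≤ k)
    {M : Submodule 𝒪[K] (Fin 3 → K)} (hM : M ∈ stratum σ ϖ T ![2 * ρ, 2 * ρ, 2 * ρ]) :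
    LatticeInLevel ϖ ℓ (Matrix.diagonal e) M ↔
      ((Valued.v (e 0) ≤ Valued.v ϖ ^ ℓ ∧ Valued.v (e 1) ≤ Valued.v ϖ ^ ℓ ∧ Valued.v (e 2) ≤ Valued.v ϖ ^ ℓ) ∧
          Valued.v (e 1 - e 0) ≤ Valued.v ϖ ^ (ℓ + ρ)) ∧ ℓ + ρ ≤ k := by
  have hvσ : ∀ a, Valued.v (σ a) = Valued.v a := hD.2.1
  have hϖ : Valued.v ϖ = exp (-1 : ℤ) := hD.2.2.1
  have hfix : ∀ x : K, σ x = x → x ≠ 0 → ∃ n : ℤ, Valued.v x = exp (2 * n) := hD.2.2.2.1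
  obtain ⟨hϖ0, hϖ1⟩ := ne_zero_and_v_lt_one_of_v_eq_exp hϖ
  have hvϖ0 : Valued.v ϖ ≠ 0 := (Valuation.ne_zero_iff _).2 hϖ0
  rw [stratum_H_eq hvσ hfix hϖ T hρ] at hM
  obtain ⟨-, -, x, ζ, y'', hx, hζ, hy, -, rfl⟩ := hM
  have hge : Valued.v ((e 2 - e 1) / (e 2 - e 0)) = 1 := by rw [map_div₀, hk, hloc, div_self (pow_ne_zero k hvϖ0)]
  have hκ : Valued.v (y'' / (x * ζ)) = 1 := by rw [map_div₀, map_mul, hx, hζ, mul_one, hy, div_one]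
  rw [latticeInLevel_diagonal_latt_coreHanging_iff_onLocus hϖ ℓ ρ k e hk hloc hx hζ y'']
  exact ⟨fun h => h.1, fun h => ⟨h, tokenBall_unit_of_le hϖ1.le hvac hκ hge⟩⟩

open Classical in
/-- **TWO-TOKEN H CELL, SECOND TOKEN VACUOUS ON ITS LOCUS** (`v(e₂ 2 − e₂ 0) = v(e₂ 2 − e₂ 1) = k₂`, `ℓ₂ + 2ρ ≤ k₂`): for ANY weight `w`,
`Σᶠ_{M ∈ H, L₁ M ∧ L₂ M} w = [outer reads₂] · Σᶠ_{M ∈ H, L₁ M} w` — the two-token cell is the one-token cell of the FIRST token.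
[cite: Kottwitz1986BaseChangeUnits, §1 pp. 240–241] [cite: Rogawski1990, §4.9 Prop. 4.9.1 (a) p. 55] -/
theorem finsum_stratum_H_sep_and_eq_of_vacuous_right (hD : IsRamifiedQuadraticDatum σ ϖ d t) (T : GL (Fin 3) K) (ρ : ℕ) (hρ : 1 ≤ ρ)
    (ℓ₁ : ℕ) (e₁ : Fin 3 → K) (ℓ₂ k₂ : ℕ) (e₂ : Fin 3 → K) (hk₂ : Valued.v (e₂ 2 - e₂ 0) = Valued.v ϖ ^ k₂) (hloc₂ : Valued.v (e₂ 2 - e₂ 1) = Valued.v ϖ ^ k₂)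
    (hvac₂ : ℓ₂ + 2 * ρ ≤ k₂) (w : Submodule 𝒪[K] (Fin 3 → K) → ℚ) :
    ∑ᶠ M ∈ {M | M ∈ stratum σ ϖ T ![2 * ρ, 2 * ρ, 2 * ρ] ∧ (LatticeInLevel ϖ ℓ₁ (Matrix.diagonal e₁) M ∧ LatticeInLevel ϖ ℓ₂ (Matrix.diagonal e₂) M)}, w M =
      if ((Valued.v (e₂ 0) ≤ Valued.v ϖ ^ ℓ₂ ∧ Valued.v (e₂ 1) ≤ Valued.v ϖ ^ ℓ₂ ∧ Valued.v (e₂ 2) ≤ Valued.v ϖ ^ ℓ₂) ∧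
          Valued.v (e₂ 1 - e₂ 0) ≤ Valued.v ϖ ^ (ℓ₂ + ρ)) ∧ ℓ₂ + ρ ≤ k₂ then
        ∑ᶠ M ∈ {M | M ∈ stratum σ ϖ T ![2 * ρ, 2 * ρ, 2 * ρ] ∧ LatticeInLevel ϖ ℓ₁ (Matrix.diagonal e₁) M}, w M
      else 0 :=
  finsum_sep_and_eq_ite_of_forall_iff_right _ _ _ _
    (fun _ hM => latticeInLevel_iff_outer_of_mem_stratum_H_of_vacuous hD T ρ hρ ℓ₂ k₂ e₂ hk₂ hloc₂ hvac₂ hM) w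

open Classical in
/-- **TWO-TOKEN H CELL, FIRST TOKEN VACUOUS ON ITS LOCUS**: `Σᶠ_{M ∈ H, L₁ M ∧ L₂ M} w = [outer reads₁] · Σᶠ_{M ∈ H, L₂ M} w`.
[cite: Kottwitz1986BaseChangeUnits, §1 pp. 240–241] [cite: Rogawski1990, §4.9 Prop. 4.9.1 (a) p. 55] -/
theorem finsum_stratum_H_sep_and_eq_of_vacuous_left (hD : IsRamifiedQuadraticDatum σ ϖ d t) (T : GL (Fin 3) K) (ρ : ℕ) (hρ : 1 ≤ ρ)
    (ℓ₁ k₁ : ℕ) (e₁ : Fin 3 → K) (hk₁ : Valued.v (e₁ 2 - e₁ 0) = Valued.v ϖ ^ k₁) (hloc₁ : Valued.v (e₁ 2 - e₁ 1) = Valued.v ϖ ^ k₁)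
    (hvac₁ : ℓ₁ + 2 * ρ ≤ k₁) (ℓ₂ : ℕ) (e₂ : Fin 3 → K) (w : Submodule 𝒪[K] (Fin 3 → K) → ℚ) :
    ∑ᶠ M ∈ {M | M ∈ stratum σ ϖ T ![2 * ρ, 2 * ρ, 2 * ρ] ∧ (LatticeInLevel ϖ ℓ₁ (Matrix.diagonal e₁) M ∧ LatticeInLevel ϖ ℓ₂ (Matrix.diagonal e₂) M)}, w M =
      if ((Valued.v (e₁ 0) ≤ Valued.v ϖ ^ ℓ₁ ∧ Valued.v (e₁ 1) ≤ Valued.v ϖ ^ ℓ₁ ∧ Valued.v (e₁ 2) ≤ Valued.v ϖ ^ ℓ₁) ∧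
          Valued.v (e₁ 1 - e₁ 0) ≤ Valued.v ϖ ^ (ℓ₁ + ρ)) ∧ ℓ₁ + ρ ≤ k₁ then
        ∑ᶠ M ∈ {M | M ∈ stratum σ ϖ T ![2 * ρ, 2 * ρ, 2 * ρ] ∧ LatticeInLevel ϖ ℓ₂ (Matrix.diagonal e₂) M}, w M
      else 0 :=
  finsum_sep_and_eq_ite_of_forall_iff_left _ _ _ _
    (fun _ hM => latticeInLevel_iff_outer_of_mem_stratum_H_of_vacuous hD T ρ hρ ℓ₁ k₁ e₁ hk₁ hloc₁ hvac₁ hM) w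

open Classical in
/-- **TWO-TOKEN H CELL, SECOND TOKEN OFF ITS LOCUS** (`|e₂ 2 − e₂ 1| ≠ |e₂ 2 − e₂ 0|`): `Σᶠ_{M ∈ H, L₁ M ∧ L₂ M} w = [reads₂] · Σᶠ_{M ∈ H, L₁ M} w` (★ p859313 read).
[cite: Kottwitz1986BaseChangeUnits, §1 pp. 240–241] [cite: Rogawski1990, §4.9 Prop. 4.9.1 (a) p. 55] -/
theorem finsum_stratum_H_sep_and_eq_of_ne_right (hD : IsRamifiedQuadraticDatum σ ϖ d t) (T : GL (Fin 3) K) (ρ : ℕ) (hρ : 1 ≤ ρ)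
    (ℓ₁ : ℕ) (e₁ : Fin 3 → K) (ℓ₂ : ℕ) (e₂ : Fin 3 → K) (hne₂ : Valued.v (e₂ 2 - e₂ 1) ≠ Valued.v (e₂ 2 - e₂ 0)) (w : Submodule 𝒪[K] (Fin 3 → K) → ℚ) :
    ∑ᶠ M ∈ {M | M ∈ stratum σ ϖ T ![2 * ρ, 2 * ρ, 2 * ρ] ∧ (LatticeInLevel ϖ ℓ₁ (Matrix.diagonal e₁) M ∧ LatticeInLevel ϖ ℓ₂ (Matrix.diagonal e₂) M)}, w M =
      if ((Valued.v (e₂ 0) ≤ Valued.v ϖ ^ ℓ₂ ∧ Valued.v (e₂ 1) ≤ Valued.v ϖ ^ ℓ₂ ∧ Valued.v (e₂ 2) ≤ Valued.v ϖ ^ ℓ₂) ∧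
          Valued.v (e₂ 1 - e₂ 0) ≤ Valued.v ϖ ^ (ℓ₂ + ρ) ∧ Valued.v (e₂ 2 - e₂ 1) ≤ Valued.v ϖ ^ (ℓ₂ + ρ) ∧
            (Valued.v (e₂ 2 - e₂ 1) ≤ Valued.v ϖ ^ (ℓ₂ + 2 * ρ) ∧ Valued.v (e₂ 2 - e₂ 0) ≤ Valued.v ϖ ^ (ℓ₂ + 2 * ρ))) then
        ∑ᶠ M ∈ {M | M ∈ stratum σ ϖ T ![2 * ρ, 2 * ρ, 2 * ρ] ∧ LatticeInLevel ϖ ℓ₁ (Matrix.diagonal e₁) M}, w M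
      else 0 := by
  have hvσ : ∀ a, Valued.v (σ a) = Valued.v a := hD.2.1
  have hϖ : Valued.v ϖ = exp (-1 : ℤ) := hD.2.2.1
  have hfix : ∀ x : K, σ x = x → x ≠ 0 → ∃ n : ℤ, Valued.v x = exp (2 * n) := hD.2.2.2.1
  have hϖ0 : ϖ ≠ 0 := (ne_zero_and_v_lt_one_of_v_eq_exp hϖ).1
  exact finsum_sep_and_eq_ite_of_forall_iff_right _ _ _ _ (fun M hM => by
    rw [stratum_H_eq hvσ hfix hϖ T hρ] at hM
    obtain ⟨-, -, x, ζ, y'', hx, hζ, hy, -, rfl⟩ := hM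
    exact latticeInLevel_diagonal_latt_H_iff_of_ne hϖ0 ℓ₂ ρ e₂ hx hζ hy hne₂) w

open Classical in
/-- **TWO-TOKEN H CELL, FIRST TOKEN OFF ITS LOCUS**: `Σᶠ_{M ∈ H, L₁ M ∧ L₂ M} w = [reads₁] · Σᶠ_{M ∈ H, L₂ M} w`. [cite: Kottwitz1986BaseChangeUnits, §1 pp. 240–241]
[cite: Rogawski1990, §4.9 Prop. 4.9.1 (a) p. 55] -/
theorem finsum_stratum_H_sep_and_eq_of_ne_left (hD : IsRamifiedQuadraticDatum σ ϖ d t) (T : GL (Fin 3) K) (ρ : ℕ) (hρ : 1 ≤ ρ)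
    (ℓ₁ : ℕ) (e₁ : Fin 3 → K) (hne₁ : Valued.v (e₁ 2 - e₁ 1) ≠ Valued.v (e₁ 2 - e₁ 0)) (ℓ₂ : ℕ) (e₂ : Fin 3 → K) (w : Submodule 𝒪[K] (Fin 3 → K) → ℚ) :
    ∑ᶠ M ∈ {M | M ∈ stratum σ ϖ T ![2 * ρ, 2 * ρ, 2 * ρ] ∧ (LatticeInLevel ϖ ℓ₁ (Matrix.diagonal e₁) M ∧ LatticeInLevel ϖ ℓ₂ (Matrix.diagonal e₂) M)}, w M =
      if ((Valued.v (e₁ 0) ≤ Valued.v ϖ ^ ℓ₁ ∧ Valued.v (e₁ 1) ≤ Valued.v ϖ ^ ℓ₁ ∧ Valued.v (e₁ 2) ≤ Valued.v ϖ ^ ℓ₁) ∧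
          Valued.v (e₁ 1 - e₁ 0) ≤ Valued.v ϖ ^ (ℓ₁ + ρ) ∧ Valued.v (e₁ 2 - e₁ 1) ≤ Valued.v ϖ ^ (ℓ₁ + ρ) ∧
            (Valued.v (e₁ 2 - e₁ 1) ≤ Valued.v ϖ ^ (ℓ₁ + 2 * ρ) ∧ Valued.v (e₁ 2 - e₁ 0) ≤ Valued.v ϖ ^ (ℓ₁ + 2 * ρ))) then
        ∑ᶠ M ∈ {M | M ∈ stratum σ ϖ T ![2 * ρ, 2 * ρ, 2 * ρ] ∧ LatticeInLevel ϖ ℓ₂ (Matrix.diagonal e₂) M}, w M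
      else 0 := by
  have hvσ : ∀ a, Valued.v (σ a) = Valued.v a := hD.2.1
  have hϖ : Valued.v ϖ = exp (-1 : ℤ) := hD.2.2.1
  have hfix : ∀ x : K, σ x = x → x ≠ 0 → ∃ n : ℤ, Valued.v x = exp (2 * n) := hD.2.2.2.1
  have hϖ0 : ϖ ≠ 0 := (ne_zero_and_v_lt_one_of_v_eq_exp hϖ).1
  exact finsum_sep_and_eq_ite_of_forall_iff_left _ _ _ _ (fun M hM => by
    rw [stratum_H_eq hvσ hfix hϖ T hρ] at hM
    obtain ⟨-, -, x, ζ, y'', hx, hζ, hy, -, rfl⟩ := hM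
    exact latticeInLevel_diagonal_latt_H_iff_of_ne hϖ0 ℓ₁ ρ e₁ hx hζ hy hne₁) w

end CoreHanging

/-! ## §3  The glued stratum `G1 (2ρ, 2ρ+2t′, 2ρ+2t′)` -/

section Glued

variable {K : Type} [Field K] [Valued K ℤᵐ⁰] {σ : K →+* K} {ϖ : K} {d t : ℕ} {T : GL (Fin 3) K}

/-- **ON THE GLUE LOCUS, IN THE VACUOUS REGIME, THE TOKEN IS ITS OUTER READ** on `G1 (2ρ, 2ρ+2t′, 2ρ+2t′)`: with `v(e₂−e₀) = k`, `v(e₂−e₁) = k + 2t′` and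
`ℓ + 2ρ ≤ k`, for every member `M` of the stratum `diag(e)M ⊆ ϖ^ℓM ⟺ ([|eᵢ| ≤ |ϖ|^ℓ] ∧ ℓ + ρ ≤ k)` (★ p859544 read, `tokenBall_of_le`).
[cite: Kottwitz1986BaseChangeUnits, §1 pp. 240–241] -/
theorem latticeInLevel_iff_outer_of_mem_stratum_G1_of_vacuous (hD : IsRamifiedQuadraticDatum σ ϖ d t) (T : GL (Fin 3) K) (ρ t' : ℕ) (hρ : 1 ≤ ρ)
    (ht' : 1 ≤ t') (ℓ k : ℕ) (e : Fin 3 → K) (hk : Valued.v (e 2 - e 0) = Valued.v ϖ ^ k) (hloc : Valued.v (e 2 - e 1) = Valued.v ϖ ^ (k + 2 * t'))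
    (hvac : ℓ + 2 * ρ ≤ k) {M : Submodule 𝒪[K] (Fin 3 → K)} (hM : M ∈ stratum σ ϖ T ![2 * ρ, 2 * ρ + 2 * t', 2 * ρ + 2 * t']) :
    LatticeInLevel ϖ ℓ (Matrix.diagonal e) M ↔
      (Valued.v (e 0) ≤ Valued.v ϖ ^ ℓ ∧ Valued.v (e 1) ≤ Valued.v ϖ ^ ℓ ∧ Valued.v (e 2) ≤ Valued.v ϖ ^ ℓ) ∧ ℓ + ρ ≤ k := by
  have hvσ : ∀ a, Valued.v (σ a) = Valued.v a := hD.2.1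
  have hϖ : Valued.v ϖ = exp (-1 : ℤ) := hD.2.2.1
  have hfix : ∀ x : K, σ x = x → x ≠ 0 → ∃ n : ℤ, Valued.v x = exp (2 * n) := hD.2.2.2.1
  obtain ⟨hϖ0, hϖ1⟩ := ne_zero_and_v_lt_one_of_v_eq_exp hϖ
  rw [stratum_G1_eq hvσ hfix hϖ T hρ (by omega : 1 ≤ 2 * t')] at hM
  obtain ⟨x, ζ, y'', hx, hζ, hy, rfl, -, -⟩ := hM
  have hκ : Valued.v (y'' / (x * ζ)) = Valued.v ϖ ^ (2 * t') := by rw [map_div₀, map_mul, hx, hζ, mul_one, div_one, hy]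
  rw [latticeInLevel_diagonal_latt_glued_iff_onLocus hϖ ℓ ρ t' k ht' e hk hloc hx hζ y'']
  exact ⟨fun h => h.1, fun h => ⟨h, tokenBall_of_le hϖ1.le hvac hκ (v_glueRatio_eq hϖ0 hk hloc)⟩⟩

open Classical in
/-- **TWO-TOKEN G1 CELL, SECOND TOKEN VACUOUS ON ITS LOCUS**: `Σᶠ_{M ∈ G1, L₁ M ∧ L₂ M} w = [outer reads₂] · Σᶠ_{M ∈ G1, L₁ M} w` for any weight `w`.
[cite: Kottwitz1986BaseChangeUnits, §1 pp. 240–241] [cite: Rogawski1990, §4.9 Prop. 4.9.1 (a) p. 55] -/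
theorem finsum_stratum_G1_sep_and_eq_of_vacuous_right (hD : IsRamifiedQuadraticDatum σ ϖ d t) (T : GL (Fin 3) K) (ρ t' : ℕ) (hρ : 1 ≤ ρ) (ht' : 1 ≤ t')
    (ℓ₁ : ℕ) (e₁ : Fin 3 → K) (ℓ₂ k₂ : ℕ) (e₂ : Fin 3 → K) (hk₂ : Valued.v (e₂ 2 - e₂ 0) = Valued.v ϖ ^ k₂)
    (hloc₂ : Valued.v (e₂ 2 - e₂ 1) = Valued.v ϖ ^ (k₂ + 2 * t')) (hvac₂ : ℓ₂ + 2 * ρ ≤ k₂) (w : Submodule 𝒪[K] (Fin 3 → K) → ℚ) :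
    ∑ᶠ M ∈ {M | M ∈ stratum σ ϖ T ![2 * ρ, 2 * ρ + 2 * t', 2 * ρ + 2 * t'] ∧
        (LatticeInLevel ϖ ℓ₁ (Matrix.diagonal e₁) M ∧ LatticeInLevel ϖ ℓ₂ (Matrix.diagonal e₂) M)}, w M =
      if (Valued.v (e₂ 0) ≤ Valued.v ϖ ^ ℓ₂ ∧ Valued.v (e₂ 1) ≤ Valued.v ϖ ^ ℓ₂ ∧ Valued.v (e₂ 2) ≤ Valued.v ϖ ^ ℓ₂) ∧ ℓ₂ + ρ ≤ k₂ then
        ∑ᶠ M ∈ {M | M ∈ stratum σ ϖ T ![2 * ρ, 2 * ρ + 2 * t', 2 * ρ + 2 * t'] ∧ LatticeInLevel ϖ ℓ₁ (Matrix.diagonal e₁) M}, w M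
      else 0 :=
  finsum_sep_and_eq_ite_of_forall_iff_right _ _ _ _
    (fun _ hM => latticeInLevel_iff_outer_of_mem_stratum_G1_of_vacuous hD T ρ t' hρ ht' ℓ₂ k₂ e₂ hk₂ hloc₂ hvac₂ hM) w

open Classical in
/-- **TWO-TOKEN G1 CELL, FIRST TOKEN VACUOUS ON ITS LOCUS**: `Σᶠ_{M ∈ G1, L₁ M ∧ L₂ M} w = [outer reads₁] · Σᶠ_{M ∈ G1, L₂ M} w`.
[cite: Kottwitz1986BaseChangeUnits, §1 pp. 240–241] [cite: Rogawski1990, §4.9 Prop. 4.9.1 (a) p. 55] -/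
theorem finsum_stratum_G1_sep_and_eq_of_vacuous_left (hD : IsRamifiedQuadraticDatum σ ϖ d t) (T : GL (Fin 3) K) (ρ t' : ℕ) (hρ : 1 ≤ ρ) (ht' : 1 ≤ t')
    (ℓ₁ k₁ : ℕ) (e₁ : Fin 3 → K) (hk₁ : Valued.v (e₁ 2 - e₁ 0) = Valued.v ϖ ^ k₁) (hloc₁ : Valued.v (e₁ 2 - e₁ 1) = Valued.v ϖ ^ (k₁ + 2 * t'))
    (hvac₁ : ℓ₁ + 2 * ρ ≤ k₁) (ℓ₂ : ℕ) (e₂ : Fin 3 → K) (w : Submodule 𝒪[K] (Fin 3 → K) → ℚ) :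
    ∑ᶠ M ∈ {M | M ∈ stratum σ ϖ T ![2 * ρ, 2 * ρ + 2 * t', 2 * ρ + 2 * t'] ∧
        (LatticeInLevel ϖ ℓ₁ (Matrix.diagonal e₁) M ∧ LatticeInLevel ϖ ℓ₂ (Matrix.diagonal e₂) M)}, w M =
      if (Valued.v (e₁ 0) ≤ Valued.v ϖ ^ ℓ₁ ∧ Valued.v (e₁ 1) ≤ Valued.v ϖ ^ ℓ₁ ∧ Valued.v (e₁ 2) ≤ Valued.v ϖ ^ ℓ₁) ∧ ℓ₁ + ρ ≤ k₁ then
        ∑ᶠ M ∈ {M | M ∈ stratum σ ϖ T ![2 * ρ, 2 * ρ + 2 * t', 2 * ρ + 2 * t'] ∧ LatticeInLevel ϖ ℓ₂ (Matrix.diagonal e₂) M}, w M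
      else 0 :=
  finsum_sep_and_eq_ite_of_forall_iff_left _ _ _ _
    (fun _ hM => latticeInLevel_iff_outer_of_mem_stratum_G1_of_vacuous hD T ρ t' hρ ht' ℓ₁ k₁ e₁ hk₁ hloc₁ hvac₁ hM) w

open Classical in
/-- **TWO-TOKEN G1 CELL, SECOND TOKEN OFF ITS GLUE LOCUS** (`|e₂ 2 − e₂ 1| ≠ |e₂ 2 − e₂ 0|·|ϖ|^s`, `s ≥ 1`): `Σᶠ_{M ∈ G1, L₁ M ∧ L₂ M} w = [reads₂] · Σᶠ_{M ∈ G1, L₁ M} w`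
(★ p859257 read).  At the letters of record the loci of `D₁` (`n₁ = n₂ + s`) and `D₂` (`2n₁ = 2n₂ + s`) never meet, so this (or its mirror) always applies.
[cite: Kottwitz1986BaseChangeUnits, §1 pp. 240–241] [cite: Rogawski1990, §4.9 Prop. 4.9.1 (a) p. 55] -/
theorem finsum_stratum_G1_sep_and_eq_of_ne_right (hD : IsRamifiedQuadraticDatum σ ϖ d t) (T : GL (Fin 3) K) (ρ s : ℕ) (hρ : 1 ≤ ρ) (hs : 1 ≤ s)
    (ℓ₁ : ℕ) (e₁ : Fin 3 → K) (ℓ₂ : ℕ) (e₂ : Fin 3 → K) (hne₂ : Valued.v (e₂ 2 - e₂ 1) ≠ Valued.v (e₂ 2 - e₂ 0) * Valued.v ϖ ^ s)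
    (w : Submodule 𝒪[K] (Fin 3 → K) → ℚ) :
    ∑ᶠ M ∈ {M | M ∈ stratum σ ϖ T ![2 * ρ, 2 * ρ + s, 2 * ρ + s] ∧ (LatticeInLevel ϖ ℓ₁ (Matrix.diagonal e₁) M ∧ LatticeInLevel ϖ ℓ₂ (Matrix.diagonal e₂) M)}, w M =
      if ((Valued.v (e₂ 0) ≤ Valued.v ϖ ^ ℓ₂ ∧ Valued.v (e₂ 1) ≤ Valued.v ϖ ^ ℓ₂ ∧ Valued.v (e₂ 2) ≤ Valued.v ϖ ^ ℓ₂) ∧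
          Valued.v (e₂ 1 - e₂ 0) ≤ Valued.v ϖ ^ (ℓ₂ + ρ) ∧ Valued.v (e₂ 2 - e₂ 1) ≤ Valued.v ϖ ^ (ℓ₂ + ρ + s) ∧
            (Valued.v (e₂ 2 - e₂ 1) ≤ Valued.v ϖ ^ (ℓ₂ + 2 * ρ + s) ∧ Valued.v (e₂ 2 - e₂ 0) * Valued.v ϖ ^ s ≤ Valued.v ϖ ^ (ℓ₂ + 2 * ρ + s))) then
        ∑ᶠ M ∈ {M | M ∈ stratum σ ϖ T ![2 * ρ, 2 * ρ + s, 2 * ρ + s] ∧ LatticeInLevel ϖ ℓ₁ (Matrix.diagonal e₁) M}, w M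
      else 0 := by
  have hvσ : ∀ a, Valued.v (σ a) = Valued.v a := hD.2.1
  have hϖ : Valued.v ϖ = exp (-1 : ℤ) := hD.2.2.1
  have hfix : ∀ x : K, σ x = x → x ≠ 0 → ∃ n : ℤ, Valued.v x = exp (2 * n) := hD.2.2.2.1
  have hϖ0 : ϖ ≠ 0 := (ne_zero_and_v_lt_one_of_v_eq_exp hϖ).1
  exact finsum_sep_and_eq_ite_of_forall_iff_right _ _ _ _ (fun M hM => by
    rw [stratum_G1_eq hvσ hfix hϖ T hρ hs] at hM
    obtain ⟨x, ζ, y'', hx, hζ, hy, rfl, -, -⟩ := hM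
    exact latticeInLevel_diagonal_latt_G1_iff_of_ne hϖ0 ℓ₂ ρ s e₂ hx hζ hy hne₂) w

open Classical in
/-- **TWO-TOKEN G1 CELL, FIRST TOKEN OFF ITS GLUE LOCUS**: `Σᶠ_{M ∈ G1, L₁ M ∧ L₂ M} w = [reads₁] · Σᶠ_{M ∈ G1, L₂ M} w`.
[cite: Kottwitz1986BaseChangeUnits, §1 pp. 240–241] [cite: Rogawski1990, §4.9 Prop. 4.9.1 (a) p. 55] -/
theorem finsum_stratum_G1_sep_and_eq_of_ne_left (hD : IsRamifiedQuadraticDatum σ ϖ d t) (T : GL (Fin 3) K) (ρ s : ℕ) (hρ : 1 ≤ ρ) (hs : 1 ≤ s)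
    (ℓ₁ : ℕ) (e₁ : Fin 3 → K) (hne₁ : Valued.v (e₁ 2 - e₁ 1) ≠ Valued.v (e₁ 2 - e₁ 0) * Valued.v ϖ ^ s) (ℓ₂ : ℕ) (e₂ : Fin 3 → K)
    (w : Submodule 𝒪[K] (Fin 3 → K) → ℚ) :
    ∑ᶠ M ∈ {M | M ∈ stratum σ ϖ T ![2 * ρ, 2 * ρ + s, 2 * ρ + s] ∧ (LatticeInLevel ϖ ℓ₁ (Matrix.diagonal e₁) M ∧ LatticeInLevel ϖ ℓ₂ (Matrix.diagonal e₂) M)}, w M =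
      if ((Valued.v (e₁ 0) ≤ Valued.v ϖ ^ ℓ₁ ∧ Valued.v (e₁ 1) ≤ Valued.v ϖ ^ ℓ₁ ∧ Valued.v (e₁ 2) ≤ Valued.v ϖ ^ ℓ₁) ∧
          Valued.v (e₁ 1 - e₁ 0) ≤ Valued.v ϖ ^ (ℓ₁ + ρ) ∧ Valued.v (e₁ 2 - e₁ 1) ≤ Valued.v ϖ ^ (ℓ₁ + ρ + s) ∧
            (Valued.v (e₁ 2 - e₁ 1) ≤ Valued.v ϖ ^ (ℓ₁ + 2 * ρ + s) ∧ Valued.v (e₁ 2 - e₁ 0) * Valued.v ϖ ^ s ≤ Valued.v ϖ ^ (ℓ₁ + 2 * ρ + s))) then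
        ∑ᶠ M ∈ {M | M ∈ stratum σ ϖ T ![2 * ρ, 2 * ρ + s, 2 * ρ + s] ∧ LatticeInLevel ϖ ℓ₂ (Matrix.diagonal e₂) M}, w M
      else 0 := by
  have hvσ : ∀ a, Valued.v (σ a) = Valued.v a := hD.2.1
  have hϖ : Valued.v ϖ = exp (-1 : ℤ) := hD.2.2.1
  have hfix : ∀ x : K, σ x = x → x ≠ 0 → ∃ n : ℤ, Valued.v x = exp (2 * n) := hD.2.2.2.1
  have hϖ0 : ϖ ≠ 0 := (ne_zero_and_v_lt_one_of_v_eq_exp hϖ).1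
  exact finsum_sep_and_eq_ite_of_forall_iff_left _ _ _ _ (fun M hM => by
    rw [stratum_G1_eq hvσ hfix hϖ T hρ hs] at hM
    obtain ⟨x, ζ, y'', hx, hζ, hy, rfl, -, -⟩ := hM
    exact latticeInLevel_diagonal_latt_G1_iff_of_ne hϖ0 ℓ₁ ρ s e₁ hx hζ hy hne₁) w

end Glued

/-! ## §4  Both tokens genuine without a common fixed witness: the cell is empty -/

section NoWitness

variable {K : Type} [Field K] [Valued K ℤᵐ⁰] {σ : K →+* K} {ϖ : K} {d t : ℕ} {T : GL (Fin 3) K}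

/-- **H, BOTH TOKENS ON THE LOCUS, NO COMMON FIXED WITNESS ⇒ THE TWO-TOKEN CELL IS EMPTY**: with `v(eⱼ 2 − eⱼ 0) = v(eⱼ 2 − eⱼ 1) = kⱼ` and
`Eⱼ = ℓⱼ + 2ρ − kⱼ ≥ 1` (both GENUINE, `j = 1, 2`), if no `σ`-fixed `f` has `|f + g_{e₁}| ≤ |ϖ|^{E₁}` and `|f + g_{e₂}| ≤ |ϖ|^{E₂}`, then no member of `H (2ρ, 2ρ, 2ρ)` carries both
tokens — dualisability puts a fixed `f` within `𝔭^ρ` of `κ` (★ B7 (iv) criterion), and both token balls are class conditions (`Eⱼ ≤ ρ` by the outer reads).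
[cite: Kottwitz1986BaseChangeUnits, §1 pp. 240–241] [cite: Serre1980Trees, II §1.1] -/
theorem stratum_H_sep_and_eq_empty_of_no_common_witness (hD : IsRamifiedQuadraticDatum σ ϖ d t) (h2 : Valued.v (2 : K) < 1) (T : GL (Fin 3) K)
    (ρ : ℕ) (hρ : 1 ≤ ρ) (ℓ₁ k₁ : ℕ) (e₁ : Fin 3 → K) (hk₁ : Valued.v (e₁ 2 - e₁ 0) = Valued.v ϖ ^ k₁) (hloc₁ : Valued.v (e₁ 2 - e₁ 1) = Valued.v ϖ ^ k₁)
    (ℓ₂ k₂ : ℕ) (e₂ : Fin 3 → K) (hk₂ : Valued.v (e₂ 2 - e₂ 0) = Valued.v ϖ ^ k₂) (hloc₂ : Valued.v (e₂ 2 - e₂ 1) = Valued.v ϖ ^ k₂)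
    (hgen₁ : k₁ < ℓ₁ + 2 * ρ) (hgen₂ : k₂ < ℓ₂ + 2 * ρ)
    (hno : ¬ ∃ f : K, σ f = f ∧ Valued.v (f + (e₁ 2 - e₁ 1) / (e₁ 2 - e₁ 0)) ≤ Valued.v ϖ ^ (ℓ₁ + 2 * ρ - k₁) ∧
      Valued.v (f + (e₂ 2 - e₂ 1) / (e₂ 2 - e₂ 0)) ≤ Valued.v ϖ ^ (ℓ₂ + 2 * ρ - k₂)) :
    {M | M ∈ stratum σ ϖ T ![2 * ρ, 2 * ρ, 2 * ρ] ∧ (LatticeInLevel ϖ ℓ₁ (Matrix.diagonal e₁) M ∧ LatticeInLevel ϖ ℓ₂ (Matrix.diagonal e₂) M)} = ∅ := by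
  have hTr := trace_bound_of_isRamifiedQuadraticDatum hD h2
  have hσ : ∀ x, σ (σ x) = x := hD.1
  have hvσ : ∀ a, Valued.v (σ a) = Valued.v a := hD.2.1
  have hϖ : Valued.v ϖ = exp (-1 : ℤ) := hD.2.2.1
  have hfix : ∀ x : K, σ x = x → x ≠ 0 → ∃ n : ℤ, Valued.v x = exp (2 * n) := hD.2.2.2.1
  obtain ⟨hϖ0, hϖ1⟩ := ne_zero_and_v_lt_one_of_v_eq_exp hϖ
  refine Set.eq_empty_of_forall_notMem fun M ⟨hM, hL₁, hL₂⟩ => hno ?_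
  rw [stratum_H_eq hvσ hfix hϖ T hρ] at hM
  obtain ⟨-, hdual, x, ζ, y'', hx, hζ, hy, hxy, rfl⟩ := hM
  obtain ⟨⟨hout₁, hle₁⟩, hb₁⟩ := (latticeInLevel_diagonal_latt_coreHanging_iff_onLocus hϖ ℓ₁ ρ k₁ e₁ hk₁ hloc₁ hx hζ y'').1 hL₁
  obtain ⟨⟨hout₂, hle₂⟩, hb₂⟩ := (latticeInLevel_diagonal_latt_coreHanging_iff_onLocus hϖ ℓ₂ ρ k₂ e₂ hk₂ hloc₂ hx hζ y'').1 hL₂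
  obtain ⟨V, hV⟩ := exists_gl_coe_eq_glued x ζ y'' (pow_ne_zero ρ hϖ0) (pow_ne_zero (2 * ρ) hϖ0)
  obtain ⟨f, hσf, hκf⟩ := (isDualisableLattice_latt_coreHanging_iff_exists_fixed_kappa hσ hvσ hϖ0 hϖ1 hTr ρ hρ hx hζ hy hxy V hV).1 (by rw [hV]; exact hdual)
  have hE₁ : ℓ₁ + 2 * ρ = k₁ + (ℓ₁ + 2 * ρ - k₁) := by omega
  have hE₂ : ℓ₂ + 2 * ρ = k₂ + (ℓ₂ + 2 * ρ - k₂) := by omega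
  rw [hE₁, pow_mul_le_pow_add_iff hϖ0] at hb₁
  rw [hE₂, pow_mul_le_pow_add_iff hϖ0] at hb₂
  refine ⟨f, hσf, ?_, ?_⟩
  · rw [show f + (e₁ 2 - e₁ 1) / (e₁ 2 - e₁ 0) = (y'' / (x * ζ) + (e₁ 2 - e₁ 1) / (e₁ 2 - e₁ 0)) - (y'' / (x * ζ) - f) by ring]
    exact Valuation.map_sub_le _ hb₁ (hκf.trans (pow_le_pow_right_of_le_one' hϖ1.le (by omega)))
  · rw [show f + (e₂ 2 - e₂ 1) / (e₂ 2 - e₂ 0) = (y'' / (x * ζ) + (e₂ 2 - e₂ 1) / (e₂ 2 - e₂ 0)) - (y'' / (x * ζ) - f) by ring]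
    exact Valuation.map_sub_le _ hb₂ (hκf.trans (pow_le_pow_right_of_le_one' hϖ1.le (by omega)))

/-- Hence every weighted two-token H cell vanishes in that case. [cite: Kottwitz1986BaseChangeUnits, §1 pp. 240–241] -/
theorem finsum_stratum_H_sep_and_eq_zero_of_no_common_witness (hD : IsRamifiedQuadraticDatum σ ϖ d t) (h2 : Valued.v (2 : K) < 1) (T : GL (Fin 3) K)
    (ρ : ℕ) (hρ : 1 ≤ ρ) (ℓ₁ k₁ : ℕ) (e₁ : Fin 3 → K) (hk₁ : Valued.v (e₁ 2 - e₁ 0) = Valued.v ϖ ^ k₁) (hloc₁ : Valued.v (e₁ 2 - e₁ 1) = Valued.v ϖ ^ k₁)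
    (ℓ₂ k₂ : ℕ) (e₂ : Fin 3 → K) (hk₂ : Valued.v (e₂ 2 - e₂ 0) = Valued.v ϖ ^ k₂) (hloc₂ : Valued.v (e₂ 2 - e₂ 1) = Valued.v ϖ ^ k₂)
    (hgen₁ : k₁ < ℓ₁ + 2 * ρ) (hgen₂ : k₂ < ℓ₂ + 2 * ρ)
    (hno : ¬ ∃ f : K, σ f = f ∧ Valued.v (f + (e₁ 2 - e₁ 1) / (e₁ 2 - e₁ 0)) ≤ Valued.v ϖ ^ (ℓ₁ + 2 * ρ - k₁) ∧
      Valued.v (f + (e₂ 2 - e₂ 1) / (e₂ 2 - e₂ 0)) ≤ Valued.v ϖ ^ (ℓ₂ + 2 * ρ - k₂)) (w : Submodule 𝒪[K] (Fin 3 → K) → ℚ) :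
    ∑ᶠ M ∈ {M | M ∈ stratum σ ϖ T ![2 * ρ, 2 * ρ, 2 * ρ] ∧ (LatticeInLevel ϖ ℓ₁ (Matrix.diagonal e₁) M ∧ LatticeInLevel ϖ ℓ₂ (Matrix.diagonal e₂) M)}, w M = 0 := by
  rw [stratum_H_sep_and_eq_empty_of_no_common_witness hD h2 T ρ hρ ℓ₁ k₁ e₁ hk₁ hloc₁ ℓ₂ k₂ e₂ hk₂ hloc₂ hgen₁ hgen₂ hno, finsum_mem_empty]

/-- **G1, BOTH TOKENS ON THE GLUE LOCUS, NO COMMON FIXED WITNESS ⇒ THE TWO-TOKEN CELL IS EMPTY** (`v(eⱼ 2 − eⱼ 0) = kⱼ`, `v(eⱼ 2 − eⱼ 1) = kⱼ + 2t′`,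
`Eⱼ = ℓⱼ + 2ρ + 2t′ − kⱼ`, both genuine `kⱼ < ℓⱼ + 2ρ`): the same, with ★ (iv-a)'s criterion (fixed `f` within `𝔭^{ρ+2t′}` of `κ`). [cite: Kottwitz1986BaseChangeUnits, §1 pp. 240–241] [cite: Serre1980Trees, II §1.1] -/
theorem stratum_G1_sep_and_eq_empty_of_no_common_witness (hD : IsRamifiedQuadraticDatum σ ϖ d t) (h2 : Valued.v (2 : K) < 1) (T : GL (Fin 3) K)
    (ρ t' : ℕ) (hρ : 1 ≤ ρ) (ht' : 1 ≤ t') (ℓ₁ k₁ : ℕ) (e₁ : Fin 3 → K) (hk₁ : Valued.v (e₁ 2 - e₁ 0) = Valued.v ϖ ^ k₁)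
    (hloc₁ : Valued.v (e₁ 2 - e₁ 1) = Valued.v ϖ ^ (k₁ + 2 * t')) (ℓ₂ k₂ : ℕ) (e₂ : Fin 3 → K) (hk₂ : Valued.v (e₂ 2 - e₂ 0) = Valued.v ϖ ^ k₂)
    (hloc₂ : Valued.v (e₂ 2 - e₂ 1) = Valued.v ϖ ^ (k₂ + 2 * t')) (hgen₁ : k₁ < ℓ₁ + 2 * ρ) (hgen₂ : k₂ < ℓ₂ + 2 * ρ)
    (hno : ¬ ∃ f : K, σ f = f ∧ Valued.v (f + (e₁ 2 - e₁ 1) / (e₁ 2 - e₁ 0)) ≤ Valued.v ϖ ^ (ℓ₁ + 2 * ρ + 2 * t' - k₁) ∧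
      Valued.v (f + (e₂ 2 - e₂ 1) / (e₂ 2 - e₂ 0)) ≤ Valued.v ϖ ^ (ℓ₂ + 2 * ρ + 2 * t' - k₂)) :
    {M | M ∈ stratum σ ϖ T ![2 * ρ, 2 * ρ + 2 * t', 2 * ρ + 2 * t'] ∧
      (LatticeInLevel ϖ ℓ₁ (Matrix.diagonal e₁) M ∧ LatticeInLevel ϖ ℓ₂ (Matrix.diagonal e₂) M)} = ∅ := by
  have hTr := trace_bound_of_isRamifiedQuadraticDatum hD h2
  have hσ : ∀ x, σ (σ x) = x := hD.1
  have hvσ : ∀ a, Valued.v (σ a) = Valued.v a := hD.2.1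
  have hϖ : Valued.v ϖ = exp (-1 : ℤ) := hD.2.2.1
  have hfix : ∀ x : K, σ x = x → x ≠ 0 → ∃ n : ℤ, Valued.v x = exp (2 * n) := hD.2.2.2.1
  obtain ⟨hϖ0, hϖ1⟩ := ne_zero_and_v_lt_one_of_v_eq_exp hϖ
  refine Set.eq_empty_of_forall_notMem fun M ⟨hM, hL₁, hL₂⟩ => hno ?_
  rw [stratum_G1_eq hvσ hfix hϖ T hρ (by omega : 1 ≤ 2 * t')] at hM
  obtain ⟨x, ζ, y'', hx, hζ, hy, rfl, -, hdual⟩ := hM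
  obtain ⟨⟨hout₁, hle₁⟩, hb₁⟩ := (latticeInLevel_diagonal_latt_glued_iff_onLocus hϖ ℓ₁ ρ t' k₁ ht' e₁ hk₁ hloc₁ hx hζ y'').1 hL₁
  obtain ⟨⟨hout₂, hle₂⟩, hb₂⟩ := (latticeInLevel_diagonal_latt_glued_iff_onLocus hϖ ℓ₂ ρ t' k₂ ht' e₂ hk₂ hloc₂ hx hζ y'').1 hL₂
  obtain ⟨V, hV⟩ := exists_gl_coe_eq_glued x ζ y'' (pow_ne_zero ρ hϖ0) (pow_ne_zero (2 * ρ + 2 * t') hϖ0)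
  obtain ⟨f, hσf, hκf⟩ := (isDualisableLattice_latt_glued_iff_exists_fixed_kappa hσ hvσ hϖ0 hϖ1 hTr ρ t' hρ ht' hx hζ hy V hV).1 (by rw [hV]; exact hdual)
  have hE₁ : ℓ₁ + 2 * ρ + 2 * t' = k₁ + (ℓ₁ + 2 * ρ + 2 * t' - k₁) := by omega
  have hE₂ : ℓ₂ + 2 * ρ + 2 * t' = k₂ + (ℓ₂ + 2 * ρ + 2 * t' - k₂) := by omega
  rw [hE₁, pow_mul_le_pow_add_iff hϖ0] at hb₁
  rw [hE₂, pow_mul_le_pow_add_iff hϖ0] at hb₂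
  refine ⟨f, hσf, ?_, ?_⟩
  · rw [show f + (e₁ 2 - e₁ 1) / (e₁ 2 - e₁ 0) = (y'' / (x * ζ) + (e₁ 2 - e₁ 1) / (e₁ 2 - e₁ 0)) - (y'' / (x * ζ) - f) by ring]
    exact Valuation.map_sub_le _ hb₁ (hκf.trans (pow_le_pow_right_of_le_one' hϖ1.le (by omega)))
  · rw [show f + (e₂ 2 - e₂ 1) / (e₂ 2 - e₂ 0) = (y'' / (x * ζ) + (e₂ 2 - e₂ 1) / (e₂ 2 - e₂ 0)) - (y'' / (x * ζ) - f) by ring]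
    exact Valuation.map_sub_le _ hb₂ (hκf.trans (pow_le_pow_right_of_le_one' hϖ1.le (by omega)))

/-- Hence every weighted two-token G1 cell vanishes in that case. [cite: Kottwitz1986BaseChangeUnits, §1 pp. 240–241] -/
theorem finsum_stratum_G1_sep_and_eq_zero_of_no_common_witness (hD : IsRamifiedQuadraticDatum σ ϖ d t) (h2 : Valued.v (2 : K) < 1) (T : GL (Fin 3) K)
    (ρ t' : ℕ) (hρ : 1 ≤ ρ) (ht' : 1 ≤ t') (ℓ₁ k₁ : ℕ) (e₁ : Fin 3 → K) (hk₁ : Valued.v (e₁ 2 - e₁ 0) = Valued.v ϖ ^ k₁)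
    (hloc₁ : Valued.v (e₁ 2 - e₁ 1) = Valued.v ϖ ^ (k₁ + 2 * t')) (ℓ₂ k₂ : ℕ) (e₂ : Fin 3 → K) (hk₂ : Valued.v (e₂ 2 - e₂ 0) = Valued.v ϖ ^ k₂)
    (hloc₂ : Valued.v (e₂ 2 - e₂ 1) = Valued.v ϖ ^ (k₂ + 2 * t')) (hgen₁ : k₁ < ℓ₁ + 2 * ρ) (hgen₂ : k₂ < ℓ₂ + 2 * ρ)
    (hno : ¬ ∃ f : K, σ f = f ∧ Valued.v (f + (e₁ 2 - e₁ 1) / (e₁ 2 - e₁ 0)) ≤ Valued.v ϖ ^ (ℓ₁ + 2 * ρ + 2 * t' - k₁) ∧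
      Valued.v (f + (e₂ 2 - e₂ 1) / (e₂ 2 - e₂ 0)) ≤ Valued.v ϖ ^ (ℓ₂ + 2 * ρ + 2 * t' - k₂)) (w : Submodule 𝒪[K] (Fin 3 → K) → ℚ) :
    ∑ᶠ M ∈ {M | M ∈ stratum σ ϖ T ![2 * ρ, 2 * ρ + 2 * t', 2 * ρ + 2 * t'] ∧
      (LatticeInLevel ϖ ℓ₁ (Matrix.diagonal e₁) M ∧ LatticeInLevel ϖ ℓ₂ (Matrix.diagonal e₂) M)}, w M = 0 := by
  rw [stratum_G1_sep_and_eq_empty_of_no_common_witness hD h2 T ρ t' hρ ht' ℓ₁ k₁ e₁ hk₁ hloc₁ ℓ₂ k₂ e₂ hk₂ hloc₂ hgen₁ hgen₂ hno, finsum_mem_empty]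

end NoWitness

end Summit.HodgeConjecture.HodgeConjecture.Cruxes.H413.F0P3cDyRamLabelledTwoTokenReductions

end
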